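import Mathlib
import Literature.MathematicalPhysics.KineticTheory.PinnedChainResonantFinite
import HarnessLib

/-!
# `EmbeddedDrudeMourre.KineticConductivityFinite` — chord algebra of the resonant manifold

Helper file (supports item `stmt-AtomisticToContinuum-12599`, route `EmbeddedDrudeMourre`, sub-problem
`FouriersLaw`). Pure algebra/trigonometry of the 2↔2 resonant manifold
`Ω(k₁,k₂,k₃) = ω(k₁) + ω(k₂) - ω(k₃) - ω(k₁+k₂-k₃) = 0` of the pinned band `ω(k)² = ω₂ + 2(1 - cos k)`
(`PhononBoltzmann.dispersion`, `resonanceFn`, `resonantSet`):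

* `chord_relation` — the master polynomial identity: writing a pair of momenta as `h ± u` so that
  `cos(h ± u) = cx ∓ sσ` (`c = cos h`, `s = sin h`, `x = cos u`, `σ = sin u`), two pairs `(h,u)`,
  `(h,u')` with `p² = ω(h+u)²ω(h-u)²`, `p'² = ω(h+u')²ω(h-u')²` and `p - p' = 2c(x - x')`, `x ≠ x'`
  satisfy `c(2A - 4cx + 2p) = 2s²(x + x')` (`A = ω₂ + 2`).
* `sin_bracket_identity` — ON THE NON-TRIVIAL BRANCH (`k₂ ≠ k₃`, `k₁ ≠ k₃` mod `2π`) the bracket of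
  the trial function `sin` is an exact multiple of the resolved-delta Jacobian:
  `(ω(k₂) + ω(k₄)) (sin k₁ + sin k₂ - sin k₃ - sin k₄) = 4 (ω(k₄) sin k₂ - ω(k₂) sin k₄)`
  `= 4 ω(k₂)ω(k₄) (ω'(k₂) - ω'(k₄))`, `k₄ = k₁ + k₂ - k₃` — so `(bracket)²/|ω'(k₂) - ω'(k₄)|` is
  bounded and the singular denominator of [ALS06, (4.11)] is cancelled EXACTLY for `f = sin`
  (this is the quantitative form of "the singular denominator in (4.11) is cancelled" of
  Aoki–Lukkarinen–Spohn 2006, after (4.16), for this particular trial function).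
* `cos_shift_eq_or` / `mem_candidates` — in the chart `(k₁, k₃)`: every resonant `k₂` has
  `cos(k₂ + (k₁-k₃)/2) ∈ {cos((k₁+k₃)/2), X'}` with an explicit `X'`, hence lies among 12 explicit
  candidates `± arccos t - (k₁-k₃)/2 + 2nπ`, `n ∈ {-1, 0, 1}` (a uniformisation of the resonant
  fibres used for counting and for measurability downstream).

References: K. Aoki, J. Lukkarinen, H. Spohn, J. Stat. Phys. 124 (2006), §4 (4.2)–(4.11), (4.16).
-/

noncomputable section

open Real Set

namespace Summit.AtomisticToContinuum.FouriersLaw.Theorems.KineticConductivityFinite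

open Literature.MathematicalPhysics.KineticTheory.PhononBoltzmann

/-! ### 1. The master polynomial identity -/

/-- **Chord relation.** For `c² + s² = 1`, `x² + σ² = 1`, `x'² + σ'² = 1`,
`p² = (A - 2(cx - sσ))(A - 2(cx + sσ))`, `p'² = (A - 2(cx' - sσ'))(A - 2(cx' + sσ'))`,
`p - p' = 2c(x - x')` and `x ≠ x'`: `c (2A - 4cx + 2p) = 2 s² (x + x')`. (Eliminating `p + p'`
from `(p - p')(p + p') = p² - p'² = 4(x - x')(x + x' - Ac)`.) [folklore] -/
theorem chord_relation {A c s x σ x' σ' p p' : ℝ}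
    (hcs : c ^ 2 + s ^ 2 = 1) (hx : x ^ 2 + σ ^ 2 = 1) (hx' : x' ^ 2 + σ' ^ 2 = 1)
    (hp : p ^ 2 = (A - 2 * (c * x - s * σ)) * (A - 2 * (c * x + s * σ)))
    (hp' : p' ^ 2 = (A - 2 * (c * x' - s * σ')) * (A - 2 * (c * x' + s * σ')))
    (hpp : p - p' = 2 * c * (x - x')) (hne : x ≠ x') :
    c * (2 * A - 4 * c * x + 2 * p) = 2 * s ^ 2 * (x + x') := by
  have h1 : (x - x') * (2 * c * (p + p') - 4 * (x + x' - A * c)) = 0 := by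
    linear_combination hp - hp' - (p + p') * hpp - 4 * s ^ 2 * hx + 4 * s ^ 2 * hx' +
      4 * (x ^ 2 - x' ^ 2) * hcs
  have h2 : 2 * c * (p + p') - 4 * (x + x' - A * c) = 0 :=
    (mul_eq_zero.1 h1).resolve_left (sub_ne_zero.2 hne)
  linear_combination (1 / 2 : ℝ) * h2 + c * hpp - 2 * (x + x') * hcs

/-! ### 2. The `sin` bracket on the non-trivial branch -/

/-- Algebraic core of `sin_bracket_identity`: with `wⱼ` the four frequencies of the pairs `h ± u`,
`h ± u'` (`w₁² = A - 2(cx - sσ)`, …), `w₁ + w₂ = w₃ + w₄ ≠ 0` (resonance) and `x ≠ x'` (non-trivial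
branch): `(w₂ + w₄) · 2s(x - x') = 4 (w₄ (sx - cσ) - w₂ (sx' - cσ'))`. [folklore] -/
theorem sin_identity_alg {A c s x σ x' σ' w₁ w₂ w₃ w₄ : ℝ}
    (hcs : c ^ 2 + s ^ 2 = 1) (hx : x ^ 2 + σ ^ 2 = 1) (hx' : x' ^ 2 + σ' ^ 2 = 1)
    (hw₁ : w₁ ^ 2 = A - 2 * (c * x - s * σ)) (hw₂ : w₂ ^ 2 = A - 2 * (c * x + s * σ))
    (hw₃ : w₃ ^ 2 = A - 2 * (c * x' - s * σ')) (hw₄ : w₄ ^ 2 = A - 2 * (c * x' + s * σ'))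
    (hE : w₁ + w₂ ≠ 0) (hres : w₁ + w₂ = w₃ + w₄) (hne : x ≠ x') :
    (w₂ + w₄) * (2 * s * (x - x')) = 4 * (w₄ * (s * x - c * σ) - w₂ * (s * x' - c * σ')) := by
  have hpp : w₁ * w₂ - w₃ * w₄ = 2 * c * (x - x') := by
    linear_combination ((w₁ + w₂ + w₃ + w₄) / 2) * hres - (1 / 2 : ℝ) * hw₁ - (1 / 2 : ℝ) * hw₂ +
      (1 / 2 : ℝ) * hw₃ + (1 / 2 : ℝ) * hw₄
  have hp : (w₁ * w₂) ^ 2 = (A - 2 * (c * x - s * σ)) * (A - 2 * (c * x + s * σ)) := by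
    rw [mul_pow, hw₁, hw₂]
  have hp' : (w₃ * w₄) ^ 2 = (A - 2 * (c * x' - s * σ')) * (A - 2 * (c * x' + s * σ')) := by
    rw [mul_pow, hw₃, hw₄]
  have hN2 : c * (2 * A - 4 * c * x + 2 * (w₁ * w₂)) = 2 * s ^ 2 * (x + x') :=
    chord_relation hcs hx hx' hp hp' hpp hne
  have hE2 : (w₁ + w₂) ^ 2 = 2 * A - 4 * c * x + 2 * (w₁ * w₂) := by
    linear_combination hw₁ + hw₂
  have hD : 2 * (w₁ + w₂) * w₂ = (w₁ + w₂) ^ 2 - 4 * s * σ := by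
    linear_combination hw₂ - hw₁
  have hD' : 2 * (w₁ + w₂) * w₄ = (w₁ + w₂) ^ 2 - 4 * s * σ' := by
    linear_combination hw₄ - hw₃ + (w₄ - w₁ - w₂ - w₃) * hres
  have key : 2 * (w₁ + w₂) *
      ((w₂ + w₄) * (2 * s * (x - x')) - 4 * (w₄ * (s * x - c * σ) - w₂ * (s * x' - c * σ'))) = 0 := by
    linear_combination (2 * (s * (x + x') - 2 * c * σ')) * hD - (2 * (s * (x + x') - 2 * c * σ)) * hD' +
      (4 * (σ - σ') * c) * hE2 + (4 * (σ - σ')) * hN2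
  have h2E : 2 * (w₁ + w₂) ≠ 0 := mul_ne_zero two_ne_zero hE
  exact sub_eq_zero.1 ((mul_eq_zero.1 key).resolve_left h2E)

/-- `ω(k)² = (ω₂ + 2) - 2 cos k`. [folklore] -/
theorem dispersion_sq' {ω₂ : ℝ} (hω : 0 ≤ ω₂) (k : ℝ) :
    dispersion ω₂ k ^ 2 = (ω₂ + 2) - 2 * Real.cos k := by
  rw [dispersion_sq hω]; ring

/-- **The `sin` bracket identity in half-sum/half-difference variables.** For `ω₂ > 0`, if the pairs
`h ± u` and `h ± u'` are resonant (`ω(h+u) + ω(h-u) = ω(h+u') + ω(h-u')`) and `cos u ≠ cos u'`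
(non-trivial branch), then
`(ω(h-u) + ω(h-u')) (sin(h+u) + sin(h-u) - sin(h+u') - sin(h-u')) = 4 (ω(h-u') sin(h-u) - ω(h-u) sin(h-u'))`.
[cite: AokiLukkarinenSpohn2006, §4 after eq. (4.16)] -/
theorem sin_bracket_identity_half {ω₂ : ℝ} (hω : 0 < ω₂) (h u u' : ℝ)
    (hres : dispersion ω₂ (h + u) + dispersion ω₂ (h - u) =
      dispersion ω₂ (h + u') + dispersion ω₂ (h - u'))
    (hne : Real.cos u ≠ Real.cos u') :
    (dispersion ω₂ (h - u) + dispersion ω₂ (h - u')) *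
        (Real.sin (h + u) + Real.sin (h - u) - Real.sin (h + u') - Real.sin (h - u')) =
      4 * (dispersion ω₂ (h - u') * Real.sin (h - u) - dispersion ω₂ (h - u) * Real.sin (h - u')) := by
  have h1 : Real.sin (h + u) + Real.sin (h - u) - Real.sin (h + u') - Real.sin (h - u') =
      2 * Real.sin h * (Real.cos u - Real.cos u') := by
    rw [Real.sin_add, Real.sin_sub, Real.sin_add, Real.sin_sub]; ring
  rw [h1, Real.sin_sub h u, Real.sin_sub h u']
  have hw : ∀ t : ℝ, dispersion ω₂ (h + t) ^ 2 = (ω₂ + 2) - 2 * (Real.cos h * Real.cos t - Real.sin h * Real.sin t) := by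
    intro t; rw [dispersion_sq' hω.le, Real.cos_add]
  have hw' : ∀ t : ℝ, dispersion ω₂ (h - t) ^ 2 = (ω₂ + 2) - 2 * (Real.cos h * Real.cos t + Real.sin h * Real.sin t) := by
    intro t; rw [dispersion_sq' hω.le, Real.cos_sub]
  have hE : dispersion ω₂ (h + u) + dispersion ω₂ (h - u) ≠ 0 :=
    (add_pos (dispersion_pos hω _) (dispersion_pos hω _)).ne'
  exact sin_identity_alg (Real.cos_sq_add_sin_sq h) (Real.cos_sq_add_sin_sq u)
    (Real.cos_sq_add_sin_sq u') (hw u) (hw' u) (hw u') (hw' u') hE hres hne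

/-- **The `sin` bracket identity on the non-trivial resonant branch** (momenta `k₁, k₂, k₃`,
`k₄ = k₁ + k₂ - k₃`): if `Ω(k₁,k₂,k₃) = 0` and `cos((k₁-k₂)/2) ≠ cos(k₃ - (k₁+k₂)/2)` (i.e. neither
`k₂ ≡ k₃` nor `k₁ ≡ k₃` mod `2π`), then
`(ω(k₂) + ω(k₄)) (sin k₁ + sin k₂ - sin k₃ - sin k₄) = 4 (ω(k₄) sin k₂ - ω(k₂) sin k₄)`.
[cite: AokiLukkarinenSpohn2006, §4 after eq. (4.16)] -/
theorem sin_bracket_identity {ω₂ : ℝ} (hω : 0 < ω₂) {k₁ k₂ k₃ : ℝ}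
    (hres : resonanceFn ω₂ k₁ k₂ k₃ = 0)
    (hne : Real.cos ((k₁ - k₂) / 2) ≠ Real.cos (k₃ - (k₁ + k₂) / 2)) :
    (dispersion ω₂ k₂ + dispersion ω₂ (k₁ + k₂ - k₃)) *
        (Real.sin k₁ + Real.sin k₂ - Real.sin k₃ - Real.sin (k₁ + k₂ - k₃)) =
      4 * (dispersion ω₂ (k₁ + k₂ - k₃) * Real.sin k₂ - dispersion ω₂ k₂ * Real.sin (k₁ + k₂ - k₃)) := by
  have e1 : (k₁ + k₂) / 2 + (k₁ - k₂) / 2 = k₁ := by ring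
  have e2 : (k₁ + k₂) / 2 - (k₁ - k₂) / 2 = k₂ := by ring
  have e3 : (k₁ + k₂) / 2 + (k₃ - (k₁ + k₂) / 2) = k₃ := by ring
  have e4 : (k₁ + k₂) / 2 - (k₃ - (k₁ + k₂) / 2) = k₁ + k₂ - k₃ := by ring
  have h := sin_bracket_identity_half hω ((k₁ + k₂) / 2) ((k₁ - k₂) / 2) (k₃ - (k₁ + k₂) / 2)
    (by rw [e1, e2, e3, e4]; exact (resonanceFn_eq_zero_iff ω₂).1 hres) hne
  rw [e1, e2, e3, e4] at h
  exact h


/-! ### 3. Which momenta are distinct on the cell -/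

/-- Two points of the cell `(-π, π]` that differ by `2mπ` coincide. [folklore] -/
theorem eq_of_mem_Ioc_of_eq_add {a b : ℝ} (ha : a ∈ Ioc (-π) π) (hb : b ∈ Ioc (-π) π) (m : ℤ)
    (h : a = 2 * m * π + b) : a = b := by
  have h1 : (2 * (m : ℝ)) * π < 3 * π := by nlinarith [ha.1, ha.2, hb.1, hb.2, Real.pi_pos]
  have h2 : (-3) * π < (2 * (m : ℝ)) * π := by nlinarith [ha.1, ha.2, hb.1, hb.2, Real.pi_pos]
  have h1' : 2 * (m : ℝ) < 3 := lt_of_mul_lt_mul_right h1 Real.pi_pos.le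
  have h2' : (-3 : ℝ) < 2 * m := lt_of_mul_lt_mul_right h2 Real.pi_pos.le
  have h1'' : 2 * m < 3 := by exact_mod_cast h1'
  have h2'' : -3 < 2 * m := by exact_mod_cast h2'
  have hlt : |a - b| < 2 * π := by
    rw [abs_lt]; constructor <;> linarith [ha.1, ha.2, hb.1, hb.2]
  have hm : m = -1 ∨ m = 0 ∨ m = 1 := by omega
  rcases hm with rfl | rfl | rfl
  · exfalso
    have : a - b = -(2 * π) := by rw [h]; push_cast; ring
    rw [this, abs_neg, abs_of_pos (by positivity)] at hlt
    exact lt_irrefl _ hlt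
  · simpa using h
  · exfalso
    have : a - b = 2 * π := by rw [h]; push_cast; ring
    rw [this, abs_of_pos (by positivity)] at hlt
    exact lt_irrefl _ hlt

/-- **Non-triviality in the cell.** For `k₁, k₂, k₃ ∈ (-π, π]` with `k₁ ≠ k₃` and `k₂ ≠ k₃`, the
half-angle cosines of `sin_bracket_identity` differ: `cos((k₁-k₂)/2) ≠ cos(k₃ - (k₁+k₂)/2)`.
[folklore] -/
theorem cos_half_ne_of_mem_Ioc {k₁ k₂ k₃ : ℝ} (hk₁ : k₁ ∈ Ioc (-π) π) (hk₂ : k₂ ∈ Ioc (-π) π)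
    (hk₃ : k₃ ∈ Ioc (-π) π) (h13 : k₁ ≠ k₃) (h23 : k₂ ≠ k₃) :
    Real.cos ((k₁ - k₂) / 2) ≠ Real.cos (k₃ - (k₁ + k₂) / 2) := by
  intro h
  obtain ⟨m, hm | hm⟩ := Real.cos_eq_cos_iff.1 h
  · -- `k₃ - (k₁+k₂)/2 = 2mπ + (k₁-k₂)/2`, i.e. `k₃ = 2mπ + k₁`
    have hk : k₃ = 2 * m * π + k₁ := by linarith
    exact h13 (eq_of_mem_Ioc_of_eq_add hk₃ hk₁ m hk).symm
  · -- `k₃ - (k₁+k₂)/2 = 2mπ - (k₁-k₂)/2`, i.e. `k₃ = 2mπ + k₂`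
    have hk : k₃ = 2 * m * π + k₂ := by linarith
    exact h23 (eq_of_mem_Ioc_of_eq_add hk₃ hk₂ m hk).symm

/-! ### 4. The chart `(k₁, k₃)`: the two admissible values of `cos(k₂ + (k₁-k₃)/2)` -/

/-- Difference-chart chord relation in half variables: if `ω(Q+e) + ω(Q'-e) = ω(Q-e) + ω(Q'+e)`
(resonance of `k₁ = Q+e`, `k₂ = Q'-e`, `k₃ = Q-e`, `k₄ = Q'+e`) and `cos Q ≠ cos Q'`, then
`cos e · (ω(Q+e) - ω(Q-e))² = 2 sin²e (cos Q + cos Q')`. [folklore] -/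
theorem cos_shift_relation_half {ω₂ : ℝ} (hω : 0 < ω₂) (Q e Q' : ℝ)
    (hres : dispersion ω₂ (Q + e) + dispersion ω₂ (Q' - e) =
      dispersion ω₂ (Q - e) + dispersion ω₂ (Q' + e))
    (hne : Real.cos Q ≠ Real.cos Q') :
    Real.cos e * (dispersion ω₂ (Q + e) - dispersion ω₂ (Q - e)) ^ 2 =
      2 * Real.sin e ^ 2 * (Real.cos Q + Real.cos Q') := by
  have hw₁ : dispersion ω₂ (Q + e) ^ 2 =
      (ω₂ + 2) - 2 * (Real.cos e * Real.cos Q - Real.sin e * Real.sin Q) := by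
    rw [dispersion_sq' hω.le, Real.cos_add]; ring
  have hw₃ : dispersion ω₂ (Q - e) ^ 2 =
      (ω₂ + 2) - 2 * (Real.cos e * Real.cos Q + Real.sin e * Real.sin Q) := by
    rw [dispersion_sq' hω.le, Real.cos_sub]; ring
  have hw₄ : dispersion ω₂ (Q' + e) ^ 2 =
      (ω₂ + 2) - 2 * (Real.cos e * Real.cos Q' - Real.sin e * Real.sin Q') := by
    rw [dispersion_sq' hω.le, Real.cos_add]; ring
  have hw₂ : dispersion ω₂ (Q' - e) ^ 2 =
      (ω₂ + 2) - 2 * (Real.cos e * Real.cos Q' + Real.sin e * Real.sin Q') := by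
    rw [dispersion_sq' hω.le, Real.cos_sub]; ring
  set w₁ := dispersion ω₂ (Q + e)
  set w₃ := dispersion ω₂ (Q - e)
  set w₄ := dispersion ω₂ (Q' + e)
  set w₂ := dispersion ω₂ (Q' - e)
  have hpp : (-(w₁ * w₃)) - (-(w₄ * w₂)) = 2 * Real.cos e * (Real.cos Q - Real.cos Q') := by
    linear_combination ((w₁ - w₃ + w₄ - w₂) / 2) * hres - (1 / 2 : ℝ) * hw₁ - (1 / 2 : ℝ) * hw₃ +
      (1 / 2 : ℝ) * hw₄ + (1 / 2 : ℝ) * hw₂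
  have hp : (-(w₁ * w₃)) ^ 2 = ((ω₂ + 2) - 2 * (Real.cos e * Real.cos Q - Real.sin e * Real.sin Q)) *
      ((ω₂ + 2) - 2 * (Real.cos e * Real.cos Q + Real.sin e * Real.sin Q)) := by
    rw [neg_sq, mul_pow, hw₁, hw₃]
  have hp' : (-(w₄ * w₂)) ^ 2 = ((ω₂ + 2) - 2 * (Real.cos e * Real.cos Q' - Real.sin e * Real.sin Q')) *
      ((ω₂ + 2) - 2 * (Real.cos e * Real.cos Q' + Real.sin e * Real.sin Q')) := by
    rw [neg_sq, mul_pow, hw₄, hw₂]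
  have h := chord_relation (Real.cos_sq_add_sin_sq e) (Real.cos_sq_add_sin_sq Q)
    (Real.cos_sq_add_sin_sq Q') hp hp' hpp hne
  linear_combination h + Real.cos e * hw₁ + Real.cos e * hw₃

/-- **The resonant fibre in the `(k₁, k₃)`-chart.** If `Ω(k₁,k₂,k₃) = 0` then either
`cos(k₂ + (k₁-k₃)/2) = cos((k₁+k₃)/2)` (the exchange zero `k₂ ≡ k₃` and its mirror `k₂ ≡ -k₁`), or
`cos((k₁-k₃)/2) · (ω(k₁) - ω(k₃))² = 2 sin²((k₁-k₃)/2) · (cos((k₁+k₃)/2) + cos(k₂ + (k₁-k₃)/2))`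
(the non-perturbative branch; this pins `cos(k₂ + (k₁-k₃)/2)` to one further value).
[cite: AokiLukkarinenSpohn2006, §4 eqs. (4.3)-(4.6)] -/
theorem cos_shift_eq_or {ω₂ : ℝ} (hω : 0 < ω₂) {k₁ k₂ k₃ : ℝ}
    (hres : resonanceFn ω₂ k₁ k₂ k₃ = 0) :
    Real.cos (k₂ + (k₁ - k₃) / 2) = Real.cos ((k₁ + k₃) / 2) ∨
      Real.cos ((k₁ - k₃) / 2) * (dispersion ω₂ k₁ - dispersion ω₂ k₃) ^ 2 =
        2 * Real.sin ((k₁ - k₃) / 2) ^ 2 *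
          (Real.cos ((k₁ + k₃) / 2) + Real.cos (k₂ + (k₁ - k₃) / 2)) := by
  by_cases hX : Real.cos (k₂ + (k₁ - k₃) / 2) = Real.cos ((k₁ + k₃) / 2)
  · exact Or.inl hX
  · right
    have e1 : (k₁ + k₃) / 2 + (k₁ - k₃) / 2 = k₁ := by ring
    have e3 : (k₁ + k₃) / 2 - (k₁ - k₃) / 2 = k₃ := by ring
    have e2 : k₂ + (k₁ - k₃) / 2 - (k₁ - k₃) / 2 = k₂ := by ring
    have e4 : k₂ + (k₁ - k₃) / 2 + (k₁ - k₃) / 2 = k₁ + k₂ - k₃ := by ring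
    have h := cos_shift_relation_half hω ((k₁ + k₃) / 2) ((k₁ - k₃) / 2) (k₂ + (k₁ - k₃) / 2)
      (by rw [e1, e2, e3, e4]; exact (resonanceFn_eq_zero_iff ω₂).1 hres) (Ne.symm hX)
    rw [e1, e3] at h
    exact h

/-- `sin((k₁-k₃)/2) ≠ 0` for distinct `k₁, k₃` of the cell. [folklore] -/
theorem sin_half_sub_ne_zero {k₁ k₃ : ℝ} (hk₁ : k₁ ∈ Ioc (-π) π) (hk₃ : k₃ ∈ Ioc (-π) π)
    (hne : k₁ ≠ k₃) : Real.sin ((k₁ - k₃) / 2) ≠ 0 := by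
  intro h
  have h1 : -π < (k₁ - k₃) / 2 := by linarith [hk₁.1, hk₃.2]
  have h2 : (k₁ - k₃) / 2 < π := by linarith [hk₁.2, hk₃.1]
  have := (Real.sin_eq_zero_iff_of_lt_of_lt h1 h2).1 h
  exact hne (by linarith)

/-- **The twelve candidates.** For `ω₂ > 0`, `k₁ ≠ k₃` in the cell, every resonant partner
`k₂ ∈ resonantSet ω₂ k₁ k₃` is of the form `± arccos t - (k₁-k₃)/2 + 2nπ` with `n ∈ {-1, 0, 1}` and
`t` one of the two admissible values of `cos(k₂ + (k₁-k₃)/2)` from `cos_shift_eq_or`. In particular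
the resonant fibre has at most twelve points. [cite: AokiLukkarinenSpohn2006, §4 eqs. (4.3)-(4.6)] -/
theorem mem_candidates {ω₂ : ℝ} (hω : 0 < ω₂) {k₁ k₃ : ℝ} (hk₁ : k₁ ∈ Ioc (-π) π)
    (hk₃ : k₃ ∈ Ioc (-π) π) (hne : k₁ ≠ k₃) {k₂ : ℝ} (hk₂ : k₂ ∈ resonantSet ω₂ k₁ k₃) :
    ∃ t ∈ ({Real.cos ((k₁ + k₃) / 2),
        Real.cos ((k₁ - k₃) / 2) * (dispersion ω₂ k₁ - dispersion ω₂ k₃) ^ 2 /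
            (2 * Real.sin ((k₁ - k₃) / 2) ^ 2) - Real.cos ((k₁ + k₃) / 2)} : Finset ℝ),
      ∃ σ ∈ ({1, -1} : Finset ℝ), ∃ n ∈ ({-1, 0, 1} : Finset ℝ),
        k₂ = σ * Real.arccos t - (k₁ - k₃) / 2 + 2 * n * π := by
  obtain ⟨hk₂c, hres⟩ := hk₂
  have hδ := sin_half_sub_ne_zero hk₁ hk₃ hne
  -- the value of `cos (k₂ + e)`
  obtain ⟨t, ht, hcos⟩ : ∃ t ∈ ({Real.cos ((k₁ + k₃) / 2),
        Real.cos ((k₁ - k₃) / 2) * (dispersion ω₂ k₁ - dispersion ω₂ k₃) ^ 2 /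
            (2 * Real.sin ((k₁ - k₃) / 2) ^ 2) - Real.cos ((k₁ + k₃) / 2)} : Finset ℝ),
      Real.cos (k₂ + (k₁ - k₃) / 2) = t := by
    rcases cos_shift_eq_or hω hres with h | h
    · exact ⟨_, by simp, h⟩
    · refine ⟨Real.cos ((k₁ - k₃) / 2) * (dispersion ω₂ k₁ - dispersion ω₂ k₃) ^ 2 /
            (2 * Real.sin ((k₁ - k₃) / 2) ^ 2) - Real.cos ((k₁ + k₃) / 2), by simp, ?_⟩
      have h2 : (2 * Real.sin ((k₁ - k₃) / 2) ^ 2) ≠ 0 := by positivity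
      rw [eq_sub_iff_add_eq, eq_div_iff h2]
      linarith
  have ht1 : -1 ≤ t := hcos ▸ Real.neg_one_le_cos _
  have ht2 : t ≤ 1 := hcos ▸ Real.cos_le_one _
  rw [← Real.cos_arccos ht1 ht2] at hcos
  obtain ⟨m, hm⟩ := Real.cos_eq_cos_iff.1 hcos.symm
  have ha0 : 0 ≤ Real.arccos t := Real.arccos_nonneg t
  have haπ : Real.arccos t ≤ π := Real.arccos_le_pi t
  have he1 : -π < (k₁ - k₃) / 2 := by linarith [hk₁.1, hk₃.2]
  have he2 : (k₁ - k₃) / 2 < π := by linarith [hk₁.2, hk₃.1]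
  -- bounds on `m`
  have hmb : (-3) * π < (2 * (m : ℝ)) * π ∧ (2 * (m : ℝ)) * π < 3 * π := by
    rcases hm with hm | hm <;> constructor <;> nlinarith [hk₂c.1, hk₂c.2, Real.pi_pos]
  have h1' : 2 * (m : ℝ) < 3 := lt_of_mul_lt_mul_right hmb.2 Real.pi_pos.le
  have h2' : (-3 : ℝ) < 2 * m := lt_of_mul_lt_mul_right hmb.1 Real.pi_pos.le
  have h1'' : 2 * m < 3 := by exact_mod_cast h1'
  have h2'' : -3 < 2 * m := by exact_mod_cast h2'
  have hmv : (m : ℝ) ∈ ({-1, 0, 1} : Finset ℝ) := by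
    have : m = -1 ∨ m = 0 ∨ m = 1 := by omega
    rcases this with rfl | rfl | rfl <;> simp
  refine ⟨t, ht, ?_⟩
  rcases hm with hm | hm
  · exact ⟨1, by simp, m, hmv, by linarith⟩
  · exact ⟨-1, by simp, m, hmv, by linarith⟩

end Summit.AtomisticToContinuum.FouriersLaw.Theorems.KineticConductivityFinite

end
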